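import Mathlib
import HarnessLib
import Summits.Ventures.LatticeQCDFlow.Exactness.TorusWallsNull
import Literature.MathematicalPhysics.QuantumFieldTheory.MullerSchiemann1987.MS87ConjugacyClassNull
import Literature.MathematicalPhysics.QuantumFieldTheory.FiniteGaugeGroupTorus
import Summits.Ventures.LatticeQCDFlow.Scaling.WilsonActionNontrivial

/-!
# LatticeQCDFlow / Scaling — the ZERO-ACTION (flat) set of a Wilson theory is product-Haar NULL as
# soon as the maximal-trace set `{g | Re tr ρ(g) = N}` is Haar-null (`L ≥ 2`, two directions):
# unconditionally for U(1); for a finite gauge group it has mass at least `|G|^{−#edges}`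

HONEST FRAMING: exact (Metropolis-corrected) sampling algorithms for lattice gauge theory;
figures of merit are autocorrelation/cost numbers at stated couplings and volumes; no
continuum-physics claim.

Venture `LatticeQCDFlow` (cell pub-lqcd), topic `Scaling`; FANOUT row 3 (`s0-u1-a`, S0-B
implementation A, GEN-16).  NEW WORK of the cell (elementary measure theory on the torus
configuration space), not a published result; NO definition is introduced.  Row 3's weak-coupling
limit (`Scaling/IdentityFlowWeakCouplingLimit`, GEN-16: `Z(β/2)²/Z(β) → μ{T = max T}`) makes the
untrained Wilson sampler's acceptance ceiling and ESS converge, as `β → ∞`, to the product-Haar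
measure of the ZERO-ACTION set `{U | S(U) = 0}`; this file computes that set's measure in the two
extreme cases.  Setting = theory-2's Wilson lattice gauge theory (compact `G`, continuous matrix
representation `ρ`, torus `(ℤ/L)^d` with `L ≥ 2`, directions `i < j`, `S = Σ_p (N − Re tr ρ(U_p))`),
reference law `Haar^{⊗E}`:

* §1 **`pi_null_of_forall_update_null`** — Tonelli along ONE coordinate of a finite product measure
  in Mathlib's `lmarginal` form: a measurable set all of whose sections along coordinate `j` are
  `μ j`-null is `Measure.pi μ`-null (the converse direction of row 3's `ae_ae_update_notMem`);
* §2 `plaquetteHolonomy_update_fst` — as a function of the link `U(x₀, i)` with the other links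
  frozen, the holonomy of the plaquette `(x₀; i, j)` is the right translation `g ↦ g·c(U)`
  (`L ≥ 2`, `i ≠ j`: the four links of the plaquette are distinct edges); hence
  **`measure_pi_plaquetteHolonomy_mem_null`** — `Haar^{⊗E}{U | U_{p₀} ∈ K} = 0` for every
  Haar-null measurable `K ⊆ G` (right invariance of Haar on the section);
* §3 **`measure_pi_wilsonAction_eq_zero_null`** — if `Haar{g | Re tr ρ(g) = N} = 0` then
  `Haar^{⊗E}{U | S(U) = 0} = 0` (a zero-action configuration has every plaquette at maximal
  trace); the finite-group contrast **`measure_pi_wilsonAction_eq_zero_pos_of_finite`** —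
  `Haar^{⊗E}{S = 0} ≥ |G|^{−#E} > 0` (the trivial configuration is an atom);
* §4 U(1): points are Haar-null on the circle (row 10's `Exactness.haarProbability_circle_singleton`,
  imported), `circle_eq_one_of_re_eq_one` (`Re z = 1 ⇒ z = 1` on the circle), and **`measure_pi_u1_wilsonAction_eq_zero_null`** — the flat set of compact U(1)
  lattice gauge theory on `(ℤ/L)^d` (`L ≥ 2`, directions `i < j`) is Haar-null, unconditionally.

Reading (value-free; no number of ours is computed or implied): combined with the weak-coupling
limit, the untrained exact sampler of compact U(1) lattice gauge theory on any torus with `L ≥ 2`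
and two directions has acceptance ceiling, ESS and acceptance all tending to `0` as `β → ∞`, while
for a finite gauge group they stay bounded below by `|G|^{−#edges}`-type constants.  NOT CLAIMED:
the SU(N) maximal-trace set (it is `{1}`, Haar-null — not typed here); rates; any value at the cell's
`(β, L)`; nothing re-scored, SEALED.md untouched.
-/

noncomputable section

namespace Summit.Ventures.LatticeQCDFlow.Theory2

open MeasureTheory Real Set Filter Finset Function
open Literature.MathematicalPhysics.QuantumFieldTheory
open Literature.MathematicalPhysics.QuantumLattice (u1Rep u1Rep_apply continuous_u1Rep)

/-! ## §1 A product-measurable set with null sections along one coordinate is null -/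

section PiNull

variable {ι : Type*} [Fintype ι] [DecidableEq ι] {X : ι → Type*} [∀ i, MeasurableSpace (X i)]
  (μ : (i : ι) → Measure (X i)) [∀ i, SigmaFinite (μ i)]

/-- **Tonelli along one coordinate**: if every section of the measurable set `N` along coordinate
`j` is `μ j`-null, then `N` is `Measure.pi μ`-null. [folklore] -/
theorem pi_null_of_forall_update_null {N : Set ((i : ι) → X i)} (hN : MeasurableSet N) (j : ι)
    (h : ∀ x : (i : ι) → X i, μ j {a | update x j a ∈ N} = 0) (x₀ : (i : ι) → X i) :
    Measure.pi μ N = 0 := by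
  have hf : Measurable (N.indicator (1 : ((i : ι) → X i) → ENNReal)) :=
    measurable_one.indicator hN
  rw [← lintegral_indicator_one hN, lintegral_eq_lmarginal_univ x₀,
    lmarginal_erase' _ hf (Finset.mem_univ j)]
  have hG : (fun x : (i : ι) → X i => ∫⁻ a, N.indicator (1 : ((i : ι) → X i) → ENNReal)
      (update x j a) ∂μ j) = 0 := by
    funext x
    have hS : MeasurableSet {a | update x j a ∈ N} := hN.preimage (measurable_update x)
    have e : (fun a => N.indicator (1 : ((i : ι) → X i) → ENNReal) (update x j a))
        = {a | update x j a ∈ N}.indicator 1 := by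
      funext a
      by_cases ha : update x j a ∈ N <;> simp [ha]
    rw [e, lintegral_indicator_one hS, h x]
    rfl
  rw [hG]
  simp [lmarginal]

end PiNull

/-! ## §2 One plaquette read through one of its links -/

section Plaquette

variable {d L : ℕ} {G : Type*} [Group G]

/-- **The holonomy is a right translation of its first link**: for `L ≥ 2` and `i ≠ j`,
`U_{(x₀;i,j)}[U(x₀,i) := g] = g · (U(x₀+eᵢ, j) U(x₀+eⱼ, i)⁻¹ U(x₀, j)⁻¹)` (the other three links of the
plaquette are edges different from `(x₀, i)`). [folklore] -/
theorem plaquetteHolonomy_update_fst [Fact (1 < L)] (U : GaugeConfig d L G) (x₀ : Site d L)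
    {i j : Fin d} (hij : i ≠ j) (g : G) :
    plaquetteHolonomy (update U (x₀, i) g) x₀ i j
      = g * (U (x₀.shift i, j) * (U (x₀.shift j, i))⁻¹ * (U (x₀, j))⁻¹) := by
  unfold plaquetteHolonomy
  rw [update_self,
    update_of_ne (fun h => hij (congrArg Prod.snd h).symm),
    update_of_ne (fun h => Site.shift_ne_self x₀ j (congrArg Prod.fst h)),
    update_of_ne (fun h => hij (congrArg Prod.snd h).symm)]
  simp only [mul_assoc]

variable [TopologicalSpace G] [IsTopologicalGroup G] [CompactSpace G] [MeasurableSpace G]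
  [BorelSpace G] [SecondCountableTopology G]

/-- **A plaquette charges no Haar-null set**: `Haar^{⊗E}{U | U_{(x₀;i,j)} ∈ K} = 0` for every
measurable Haar-null `K ⊆ G` (`L ≥ 2`, `i ≠ j`). [ours] -/
theorem measure_pi_plaquetteHolonomy_mem_null [Fact (1 < L)] (x₀ : Site d L) {i j : Fin d}
    (hij : i ≠ j) {K : Set G} (hK : MeasurableSet K) (hK0 : haarProbability G K = 0) :
    (Measure.pi fun _ : Edge d L => haarProbability G)
      {U : GaugeConfig d L G | plaquetteHolonomy U x₀ i j ∈ K} = 0 := by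
  classical
  have hmeas : MeasurableSet {U : GaugeConfig d L G | plaquetteHolonomy U x₀ i j ∈ K} :=
    hK.preimage (measurable_plaquetteHolonomy x₀ i j)
  refine pi_null_of_forall_update_null (fun _ : Edge d L => haarProbability G) hmeas (x₀, i)
    (fun U => ?_) 1
  have e : {a : G | update U (x₀, i) a ∈ {U : GaugeConfig d L G | plaquetteHolonomy U x₀ i j ∈ K}}
      = (fun a : G => a * (U (x₀.shift i, j) * (U (x₀.shift j, i))⁻¹ * (U (x₀, j))⁻¹)) ⁻¹' K := by
    ext a
    simp only [Set.mem_setOf_eq, Set.mem_preimage, plaquetteHolonomy_update_fst U x₀ hij]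
  rw [e, measure_preimage_mul_right]
  exact hK0

end Plaquette

/-! ## §3 The zero-action set -/

section ZeroAction

variable {d L N : ℕ} [NeZero L] {G : Type*} [Group G] [TopologicalSpace G] [IsTopologicalGroup G]
  [CompactSpace G] [MeasurableSpace G] [BorelSpace G] (ρ : G →* Matrix (Fin N) (Fin N) ℂ)

omit [MeasurableSpace G] [BorelSpace G] in
/-- A zero-action configuration has maximal trace on every plaquette (`Re tr ρ ≤ N` termwise).
[folklore] -/
theorem trace_re_eq_of_wilsonAction_eq_zero (hρ : Continuous ρ) {U : GaugeConfig d L G}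
    (hU : wilsonAction ρ U = 0) (p : Plaquette d L) :
    (ρ (plaquetteHolonomy U p.1 p.2.1.1 p.2.1.2)).trace.re = N := by
  have hle : ∀ g : G, (ρ g).trace.re ≤ N := fun g => by
    have hb := Literature.RepresentationTheory.CompactGroups.CompactGroup.abs_re_trace_le_card ρ hρ g
    rw [Fintype.card_fin] at hb
    exact (le_abs_self _).trans hb
  unfold wilsonAction at hU
  have h := (Finset.sum_eq_zero_iff_of_nonneg fun q _ => sub_nonneg.2 (hle _)).1 hU p
    (Finset.mem_univ p)
  linarith

/-- **THE FLAT SET IS NULL WHEN THE MAXIMAL-TRACE SET IS**: if `Haar{g | Re tr ρ(g) = N} = 0` then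
`Haar^{⊗E}{U | S(U) = 0} = 0` (`L ≥ 2`, directions `i < j`, continuous `ρ`). [ours] -/
theorem measure_pi_wilsonAction_eq_zero_null [SecondCountableTopology G] [Fact (1 < L)]
    (hρ : Continuous ρ) {i j : Fin d}
    (hij : i < j) (hK0 : haarProbability G {g : G | (ρ g).trace.re = N} = 0) :
    (Measure.pi fun _ : Edge d L => haarProbability G)
      {U : GaugeConfig d L G | wilsonAction ρ U = 0} = 0 := by
  have hK : MeasurableSet {g : G | (ρ g).trace.re = N} :=
    measurableSet_eq_fun (Complex.continuous_re.comp (hρ.matrix_trace)).measurable measurable_const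
  refine measure_mono_null (fun U hU => ?_)
    (measure_pi_plaquetteHolonomy_mem_null (0 : Site d L) hij.ne hK hK0)
  exact trace_re_eq_of_wilsonAction_eq_zero ρ hρ hU ((0 : Site d L), ⟨(i, j), hij⟩)

/-- **Finite gauge groups: the flat set has mass at least `|G|^{−#edges}`** (the trivial
configuration alone). [ours] -/
theorem measure_pi_wilsonAction_eq_zero_pos_of_finite [Fintype G] [DiscreteTopology G] :
    ((Fintype.card G : ENNReal)⁻¹) ^ Fintype.card (Edge d L)
      ≤ (Measure.pi fun _ : Edge d L => haarProbability G)
        {U : GaugeConfig d L G | wilsonAction ρ U = 0} := by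
  rw [← pi_haarProbability_singleton (1 : GaugeConfig d L G)]
  exact measure_mono (Set.singleton_subset_iff.2 (wilsonAction_one_eq_zero ρ))

end ZeroAction

/-! ## §4 U(1): the maximal-trace set is `{1}`, a Haar-null singleton -/

section U1

/-- On the circle `Re z = 1` forces `z = 1`. [folklore] -/
theorem circle_eq_one_of_re_eq_one {z : Circle} (hz : (z : ℂ).re = 1) : z = 1 := by
  have hn : Complex.normSq (z : ℂ) = 1 := Circle.normSq_coe z
  rw [Complex.normSq_apply, hz] at hn
  have him : (z : ℂ).im = 0 := by nlinarith
  exact Circle.coe_eq_one.1 (Complex.ext (by simpa using hz) (by simpa using him))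

variable {d L : ℕ} [NeZero L] [Fact (1 < L)]

/-- **THE FLAT SET OF COMPACT U(1) LATTICE GAUGE THEORY IS HAAR-NULL** on `(ℤ/L)^d`, `L ≥ 2`,
directions `i < j` (the maximal-trace set of `u1Rep` is `{1}`). [ours] -/
theorem measure_pi_u1_wilsonAction_eq_zero_null {i j : Fin d} (hij : i < j) :
    (Measure.pi fun _ : Edge d L => haarProbability Circle)
      {U : GaugeConfig d L Circle | wilsonAction u1Rep U = 0} = 0 := by
  refine measure_pi_wilsonAction_eq_zero_null u1Rep continuous_u1Rep hij ?_
  refine measure_mono_null (fun g hg => ?_) (Exactness.haarProbability_circle_singleton 1)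
  have hg' : (u1Rep g).trace.re = ((1 : ℕ) : ℝ) := hg
  rw [trace_u1Rep_re, Nat.cast_one] at hg'
  exact circle_eq_one_of_re_eq_one hg'

end U1

/-! ## §5 SU(2): the maximal-trace set is the conjugacy class `{u₀ = 1}`, Haar-null (appended GEN-16) -/

section SU2

open Literature.MathematicalPhysics.QuantumLattice (fundamentalRep fundamentalRep_apply
  continuous_fundamentalRep)
open Literature.MathematicalPhysics.QuantumFieldTheory.MullerSchiemann1987

variable {d L : ℕ} [NeZero L] [Fact (1 < L)]

/-- **THE FLAT SET OF SU(2) LATTICE GAUGE THEORY IS HAAR-NULL** on `(ℤ/L)^d`, `L ≥ 2`, directions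
`i < j`: the maximal-trace set `{g ∈ SU(2) | Re tr g = 2}` lies in the conjugacy class `{u₀ = 1}`,
Haar-null by the tree's `MullerSchiemann1987.ConjugacyClassNull.haar_setOf_u0_eq_eq_zero`. [ours] -/
theorem measure_pi_su2_wilsonAction_eq_zero_null {i j : Fin d} (hij : i < j) :
    (Measure.pi fun _ : Edge d L => haarProbability (Matrix.specialUnitaryGroup (Fin 2) ℂ))
      {U : GaugeConfig d L (Matrix.specialUnitaryGroup (Fin 2) ℂ) |
        wilsonAction (fundamentalRep (Fin 2)) U = 0} = 0 := by
  refine measure_pi_wilsonAction_eq_zero_null (fundamentalRep (Fin 2)) (continuous_fundamentalRep (Fin 2))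
    hij ?_
  refine measure_mono_null (fun g hg => ?_) (ConjugacyClassNull.haar_setOf_u0_eq_eq_zero 1)
  have hg' : ((fundamentalRep (Fin 2) g).trace).re = ((2 : ℕ) : ℝ) := hg
  show HeatKernel.u0 g = 1
  rw [← HeatKernel.trace_re_div_two, ← fundamentalRep_apply, hg']
  norm_num

end SU2

end Summit.Ventures.LatticeQCDFlow.Theory2

end
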